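import Mathlib
import Summits.NavierStokesRegularity.NavierStokesRegularity.Theorems.WakeRatchetAdmissibleEternalBoundFedSpike
import HarnessLib

/-!
# ENERGY PERSISTENCE: admissible eternal solutions are uniformly bounded wherever the cascade is
# FORWARD — the inviscid forward-cascade slice of `WakeRatchet.AdmissibleEternalBound`
# (stmt-NavierStokesRegularity-23197) is a theorem

The crux `AdmissibleEternalBound` asks that every admissible eternal solution (`IsEternalVisc ε₀ ν̂ α W`:
renormalised lattice law with covariant viscosity `ν̂ ≥ 0`, UNIFORM per-shell action `∫‖W_n‖ ≤ M`,
per-shell forward energy bound) of an E₂(R) table be `UniformBound`.  The companion files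
`WakeRatchetAdmissibleEternalBoundFedSpike` / `…SmallAction` showed that the route's «fed spike» lever
only bounds a shell by the shell BELOW it with a factor `K ≥ 1`.  This file proves a DIFFERENT
mechanism that does give a uniform bound, and identifies exactly where it leaks.

ENERGY PERSISTENCE.  By the shell energy identity `E_b' = F_{b-1} − F_b − 2ν̂_b E_b`
(`hasDerivAt_physEnergy`, cancellation (4.3)) and `|F_b| ≤ 2C_AΛ⁻¹‖W_{b+1}‖E_b` (`abs_physFlux_le`),
as long as shell `b` does not scatter energy BACK to shell `b−1` (`F_{b-1} ≥ 0`) its PHYSICAL energy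
can decrease after `σ₀` at most by the factor `exp(−2C_AΛ⁻¹∫‖W_{b+1}‖ − 2∫ν̂_b) ≥ e^{−2C_A M/Λ − 2·viscCoef(b,σ₀)}`
— forward transfer is paid for by the ACTION of the receiving shell, and the dissipation budget of a
shell is finite forward in log-time.  A persisting physical energy forces
`‖W_b(σ)‖ ≥ ‖W_b(σ₀)‖ e^{−(σ−σ₀)} e^{−(C_A M/Λ + viscCoef)}`, whose own action over `[σ₀, ∞)` is its
height: hence `‖W_b(σ₀)‖ ≤ M exp(C_A M/Λ + viscCoef(b, σ₀))` (`norm_le_of_forwardFlux`).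

* `uniformBound_of_forwardCascade`, `norm_le_of_forwardCascade` — every admissible INVISCID eternal
  solution of a cancelling table whose energy fluxes are all non-negative (no backscatter) is
  `UniformBound`, with constant `M e^{C_A M/Λ}`; no smallness of `ε₀`, no comparability.
* `admissibleEternalBound_inviscid_forwardCascade` — the crux in its own quantifier shape on that
  slice; `uniformBound_dyadic_of_nonneg` — every non-negative admissible inviscid eternal solution of
  the dyadic member `dyadicTable` is uniformly bounded (fluxes `∝ W_{n+1,0}W_{n,0}² ≥ 0`).
* `norm_le_of_forwardFlux_of_viscCoef_le` — with viscosity the same bound holds at all shells at or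
  below the dissipation cutoff (`viscCoef(b,σ₀) ≤ Γ₀`).

WHAT REMAINS OF THE CRUX (for the planner): exactly the two leaks of persistence — (i) BACKSCATTER
(`F_{b-1} < 0`: energy of a vigorous shell returning to larger scales, where the self-similar clock is
slower, is not charged to any action) and (ii) the DISSIPATION RANGE (`viscCoef ≫ 1`: dissipation
absorbs a shell's energy without action being spent above it).  MODEL lattice ODEs only (Tao 2016
§4, §6.4); nothing in this file is a statement about the Navier–Stokes equations, and no summit or
rung is proved by it.
-/

noncomputable section

set_option linter.dupNamespace false

namespace Summit.NavierStokesRegularity.NavierStokesRegularity.Theorems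

namespace WakeRatchetPersistence

open Filter Topology MeasureTheory Set intervalIntegral
open scoped RealInnerProductSpace
open Literature.Analysis.FluidPDE Literature.Analysis.FluidPDE.TaoCascade
open WakeRatchetFedSpike

section Persistence

variable {m : ℕ} {ε₀ νh : ℝ} {α : Fin m → Fin m → Fin m → ℤ × ℤ × ℤ → ℝ} {W : ℤ → ℝ → Em m}

/-- The dissipation budget of shell `b` after log-time `σ₀`:
`∫_{σ₀}^{σ} 2·viscCoef(b, s) ds = 2ν̂(1+ε₀)^{2b}(e^{-σ₀} - e^{-σ}) ≤ 2·viscCoef(b, σ₀)`.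
[cite: Tao2016AveragedNS, §4, the viscous equation displayed before Thm. 4.2, §6.4; cell vocabulary (`viscCoef`)] -/
theorem integral_viscCoef_le (hε : 0 < ε₀) (hν : 0 ≤ νh) (b : ℤ) (σ₀ σ : ℝ) :
    ∫ s in σ₀..σ, 2 * viscCoef ε₀ νh b s ≤ 2 * viscCoef ε₀ νh b σ₀ := by
  have hderiv : ∀ s, HasDerivAt (fun s => -(2 * νh * (1 + ε₀) ^ ((2 : ℝ) * b) * Real.exp (-s)))
      (2 * viscCoef ε₀ νh b s) s := by
    intro s
    have h1 : HasDerivAt (fun s : ℝ => Real.exp (-s)) (Real.exp (-s) * (-1 : ℝ)) s :=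
      (hasDerivAt_neg s).exp
    have h2 := (h1.const_mul (2 * νh * (1 + ε₀) ^ ((2 : ℝ) * b))).neg
    refine h2.congr_deriv ?_
    unfold viscCoef
    ring
  have hcont : Continuous fun s => 2 * viscCoef ε₀ νh b s := by unfold viscCoef; fun_prop
  rw [integral_eq_sub_of_hasDerivAt (fun s _ => hderiv s) (hcont.intervalIntegrable _ _)]
  unfold viscCoef
  have hx : 0 < 1 + ε₀ := by linarith
  have : 0 ≤ 2 * νh * (1 + ε₀) ^ ((2 : ℝ) * b) * Real.exp (-σ) := by positivity
  linarith

/-- **ENERGY PERSISTENCE BOUND.**  On a cancelling table, for an admissible eternal solution (any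
covariant viscosity `ν̂ ≥ 0`) with per-shell action `∫‖W_n‖ ≤ M`: if from log-time `σ₀` on shell `b`
does not scatter energy back to shell `b − 1` (`0 ≤ F_{b-1}(σ)` for `σ ≥ σ₀`), then
`‖W_b(σ₀)‖ ≤ M · exp(C_A M/Λ + viscCoef(b, σ₀))`.
MECHANISM (new on this crux, replacing the fed-spike ratchet): by the shell energy identity
`E_b' = F_{b-1} − F_b − 2ν̂_b E_b` (`hasDerivAt_physEnergy`) and `|F_b| ≤ 2C_AΛ⁻¹‖W_{b+1}‖E_b`
(`abs_physFlux_le`), the PHYSICAL energy of shell `b` can decrease after `σ₀` at most by the factor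
`exp(−2C_AΛ⁻¹∫‖W_{b+1}‖ − 2∫ν̂_b) ≥ exp(−2C_A M/Λ − 2·viscCoef(b,σ₀))` (forward transfer is paid for by
the ACTION of the shell above; the dissipation budget of a shell is finite forward in log-time);
a persisting physical energy means `‖W_b(σ)‖ ≥ ‖W_b(σ₀)‖e^{-(σ-σ₀)}e^{-(C_AM/Λ + viscCoef)}`, whose
action over `[σ₀, ∞)` is its initial height — hence the bound.  No smallness of `ε₀`, no comparability.
MODEL lattice ODEs only; nothing about the Navier–Stokes equations.
[cite: Tao2016AveragedNS, §4 Lemma 4.1 (4.8)–(4.10) with the cancellation (4.3), the viscous equation before Thm. 4.2, §6.4; cell vocabulary (`IsEternalVisc`, `physEnergy`, `physFlux`)] -/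
theorem norm_le_of_forwardFlux (hε : 0 < ε₀) (hc : IsCancellingCoeff α) (hW : IsEternalVisc ε₀ νh α W)
    {M : ℝ} (hM : ∀ n : ℤ, Integrable (fun σ => ‖W n σ‖) ∧ ∫ σ, ‖W n σ‖ ≤ M)
    (b : ℤ) (σ₀ : ℝ) (hF : ∀ σ, σ₀ ≤ σ → 0 ≤ physFlux ε₀ α W (b - 1) σ) :
    ‖W b σ₀‖ ≤ M * Real.exp (fluxConst α * (bigLam ε₀)⁻¹ * M + viscCoef ε₀ νh b σ₀) := by
  have hS := table_sTable α hc
  have hΛpos : 0 < bigLam ε₀ := bigLam_pos (by linarith)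
  have hΛi : 0 ≤ (bigLam ε₀)⁻¹ := inv_nonneg.2 hΛpos.le
  have hCA : 0 ≤ fluxConst α := hS.CA_nonneg
  have hM0 : 0 ≤ M := le_trans (integral_nonneg fun _ => norm_nonneg _) (hM 0).2
  have hWc : ∀ n : ℤ, Continuous (W n) := fun n =>
    continuous_iff_continuousAt.2 fun x => (hW.law n x).continuousAt
  have hvisc0 : ∀ s, 0 ≤ viscCoef ε₀ νh b s := fun s => by
    unfold viscCoef; exact mul_nonneg hW.nonneg (by positivity)
  -- the physical energy of shell `b` and its derivative
  set E : ℝ → ℝ := physEnergy ε₀ W b with hEdef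
  have hE0 : ∀ σ, 0 ≤ E σ := fun σ => physEnergy_nonneg ε₀ W b σ
  have hEd : ∀ σ, HasDerivAt E (physFlux ε₀ α W (b - 1) σ - physFlux ε₀ α W b σ
      - 2 * viscCoef ε₀ νh b σ * E σ) σ := fun σ => hasDerivAt_physEnergy hε hW hc b σ
  -- the loss rate `q = 2C_AΛ⁻¹‖W_{b+1}‖ + 2ν̂_b` and its primitive
  set q : ℝ → ℝ := fun s => 2 * fluxConst α * (bigLam ε₀)⁻¹ * ‖W (b + 1) s‖
    + 2 * viscCoef ε₀ νh b s with hqdef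
  have hWb1 := hWc (b + 1)
  have hqc : Continuous q := by simp only [hqdef]; unfold viscCoef; fun_prop
  set J : ℝ → ℝ := fun σ => ∫ s in σ₀..σ, q s with hJdef
  have hJd : ∀ σ, HasDerivAt J (q σ) σ := fun σ =>
    intervalIntegral.integral_hasDerivAt_right (hqc.intervalIntegrable _ _)
      (hqc.stronglyMeasurableAtFilter _ _) hqc.continuousAt
  -- `E' ≥ -q E` after `σ₀`
  have hlow : ∀ σ, σ₀ ≤ σ → -(q σ * E σ) ≤ physFlux ε₀ α W (b - 1) σ - physFlux ε₀ α W b σ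
      - 2 * viscCoef ε₀ νh b σ * E σ := by
    intro σ hσ
    have h1 := hF σ hσ
    have h2 : physFlux ε₀ α W b σ ≤ 2 * fluxConst α * (bigLam ε₀)⁻¹ * ‖W (b + 1) σ‖ * E σ :=
      (le_abs_self _).trans (abs_physFlux_le hε hc W b σ)
    simp only [hqdef]
    nlinarith
  -- `ψ = E · e^{J}` is monotone on `[σ₀, ∞)`
  set ψ : ℝ → ℝ := fun σ => E σ * Real.exp (J σ) with hψdef
  have hψd : ∀ σ, HasDerivAt ψ ((physFlux ε₀ α W (b - 1) σ - physFlux ε₀ α W b σ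
      - 2 * viscCoef ε₀ νh b σ * E σ) * Real.exp (J σ) + E σ * (Real.exp (J σ) * q σ)) σ :=
    fun σ => (hEd σ).mul (hJd σ).exp
  have hψmono : MonotoneOn ψ (Ici σ₀) := by
    refine monotoneOn_of_deriv_nonneg (convex_Ici σ₀)
      (fun x _ => (hψd x).continuousAt.continuousWithinAt)
      (fun x _ => (hψd x).differentiableAt.differentiableWithinAt) ?_
    intro x hx
    rw [interior_Ici] at hx
    rw [(hψd x).deriv]
    have hl := hlow x (le_of_lt hx)
    have hexp : 0 < Real.exp (J x) := Real.exp_pos _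
    have : 0 ≤ (physFlux ε₀ α W (b - 1) x - physFlux ε₀ α W b x
        - 2 * viscCoef ε₀ νh b x * E x) + q x * E x := by linarith
    calc (0 : ℝ) ≤ ((physFlux ε₀ α W (b - 1) x - physFlux ε₀ α W b x
        - 2 * viscCoef ε₀ νh b x * E x) + q x * E x) * Real.exp (J x) := by positivity
      _ = _ := by ring
  -- the loss integral is at most `2c`, `c = C_A M/Λ + viscCoef(b, σ₀)`
  set c : ℝ := fluxConst α * (bigLam ε₀)⁻¹ * M + viscCoef ε₀ νh b σ₀ with hcdef
  have hJle : ∀ σ, σ₀ ≤ σ → J σ ≤ 2 * c := by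
    intro σ hσ
    have hsplit : J σ = 2 * fluxConst α * (bigLam ε₀)⁻¹ * (∫ s in σ₀..σ, ‖W (b + 1) s‖)
        + ∫ s in σ₀..σ, 2 * viscCoef ε₀ νh b s := by
      simp only [hJdef, hqdef]
      have c1 : IntervalIntegrable (fun s => 2 * fluxConst α * (bigLam ε₀)⁻¹ * ‖W (b + 1) s‖)
          volume σ₀ σ := ((hWc (b + 1)).norm.const_mul _).intervalIntegrable _ _
      have c2 : IntervalIntegrable (fun s => 2 * viscCoef ε₀ νh b s) volume σ₀ σ := by
        refine Continuous.intervalIntegrable ?_ _ _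
        unfold viscCoef; fun_prop
      rw [intervalIntegral.integral_add c1 c2, intervalIntegral.integral_const_mul]
    have hI1 : ∫ s in σ₀..σ, ‖W (b + 1) s‖ ≤ M :=
      (intervalIntegral_le_integral (hM (b + 1)).1 (fun _ => norm_nonneg _) hσ).trans (hM (b + 1)).2
    have hI2 := integral_viscCoef_le hε hW.nonneg b σ₀ σ
    rw [hsplit, hcdef]
    have : 2 * fluxConst α * (bigLam ε₀)⁻¹ * (∫ s in σ₀..σ, ‖W (b + 1) s‖)
        ≤ 2 * fluxConst α * (bigLam ε₀)⁻¹ * M := mul_le_mul_of_nonneg_left hI1 (by positivity)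
    linarith
  -- persistence: `E σ ≥ E σ₀ · e^{-2c}` for `σ ≥ σ₀`
  have hpers : ∀ σ, σ₀ ≤ σ → E σ₀ ≤ E σ * Real.exp (2 * c) := by
    intro σ hσ
    have h1 : ψ σ₀ ≤ ψ σ := hψmono self_mem_Ici (mem_Ici.2 hσ) hσ
    have hψ0 : ψ σ₀ = E σ₀ := by
      simp only [hψdef, hJdef, intervalIntegral.integral_same, Real.exp_zero, mul_one]
    rw [hψ0] at h1
    exact h1.trans (mul_le_mul_of_nonneg_left (Real.exp_le_exp.2 (hJle σ hσ)) (hE0 σ))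
  -- in amplitude form: `‖W_b σ‖ ≥ h e^{-c} e^{σ₀ - σ}`
  set h : ℝ := ‖W b σ₀‖ with hhdef
  have hh0 : 0 ≤ h := norm_nonneg _
  have hamp : ∀ σ, σ₀ ≤ σ → h * Real.exp (-c) * Real.exp (σ₀ - σ) ≤ ‖W b σ‖ := by
    intro σ hσ
    have hp := hpers σ hσ
    -- `E = Λ^{-2b} (e^{σ}‖W_b‖)²`
    have hΛb : 0 < (bigLam ε₀ ^ b)⁻¹ ^ 2 := by
      have := zpow_pos hΛpos b
      positivity
    have eE : ∀ x, E x = (bigLam ε₀ ^ b)⁻¹ ^ 2 * (Real.exp x * ‖W b x‖) ^ 2 := by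
      intro x
      simp only [hEdef, physEnergy]
      rw [show (2 : ℝ) * x = x + x by ring, Real.exp_add]
      ring
    rw [eE σ₀, eE σ] at hp
    have hsq : (Real.exp σ₀ * h) ^ 2 ≤ (Real.exp σ * ‖W b σ‖ * Real.exp c) ^ 2 := by
      have e2 : Real.exp (2 * c) = Real.exp c * Real.exp c := by
        rw [show (2 : ℝ) * c = c + c by ring, Real.exp_add]
      rw [e2, mul_assoc] at hp
      have := le_of_mul_le_mul_left hp hΛb
      nlinarith [this]
    have hpos : 0 ≤ Real.exp σ * ‖W b σ‖ * Real.exp c := by positivity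
    have hroot : Real.exp σ₀ * h ≤ Real.exp σ * ‖W b σ‖ * Real.exp c := by
      have := Real.sqrt_le_sqrt hsq
      rwa [Real.sqrt_sq (by positivity), Real.sqrt_sq hpos] at this
    -- divide by `e^{σ} e^{c}`
    have e3 : h * Real.exp (-c) * Real.exp (σ₀ - σ)
        = (Real.exp σ₀ * h) * (Real.exp (-c) * Real.exp (-σ)) := by
      rw [show σ₀ - σ = σ₀ + -σ by ring, Real.exp_add]; ring
    have e4 : ‖W b σ‖ = (Real.exp σ * ‖W b σ‖ * Real.exp c) * (Real.exp (-c) * Real.exp (-σ)) := by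
      have h5 : Real.exp σ * Real.exp (-σ) = 1 := by rw [← Real.exp_add]; simp
      have h6 : Real.exp c * Real.exp (-c) = 1 := by rw [← Real.exp_add]; simp
      calc ‖W b σ‖ = ‖W b σ‖ * (Real.exp σ * Real.exp (-σ)) * (Real.exp c * Real.exp (-c)) := by
            rw [h5, h6]; ring
        _ = _ := by ring
    rw [e3, e4]
    exact mul_le_mul_of_nonneg_right hroot (by positivity)
  -- integrate over `[σ₀, σ₀ + L]`: `h e^{-c} (1 - e^{-L}) ≤ M`
  have hint : ∀ L, 0 ≤ L → h * Real.exp (-c) * (1 - Real.exp (-L)) ≤ M := by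
    intro L hL
    have hWb := hWc b
    have h1 : ∫ s in σ₀..(σ₀ + L), h * Real.exp (-c) * Real.exp (σ₀ - s)
        ≤ ∫ s in σ₀..(σ₀ + L), ‖W b s‖ :=
      intervalIntegral.integral_mono_on (by linarith)
        ((by fun_prop : Continuous fun s => h * Real.exp (-c) * Real.exp (σ₀ - s)).intervalIntegrable
          _ _)
        ((hWc b).norm.intervalIntegrable _ _) (fun s hs => hamp s hs.1)
    have h2 : ∫ s in σ₀..(σ₀ + L), ‖W b s‖ ≤ M :=
      (intervalIntegral_le_integral (hM b).1 (fun _ => norm_nonneg _) (by linarith)).trans (hM b).2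
    have h3 : ∫ s in σ₀..(σ₀ + L), h * Real.exp (-c) * Real.exp (σ₀ - s)
        = h * Real.exp (-c) * (1 - Real.exp (-L)) := by
      have hd : ∀ s, HasDerivAt (fun s => -(h * Real.exp (-c) * Real.exp (σ₀ - s)))
          (h * Real.exp (-c) * Real.exp (σ₀ - s)) s := by
        intro s
        have e1 : HasDerivAt (fun s : ℝ => Real.exp (σ₀ - s)) (Real.exp (σ₀ - s) * (-1 : ℝ)) s :=
          ((hasDerivAt_id s).const_sub σ₀).exp
        have e2 := (e1.const_mul (h * Real.exp (-c))).neg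
        refine e2.congr_deriv ?_
        ring
      rw [integral_eq_sub_of_hasDerivAt (fun s _ => hd s)
        ((by fun_prop : Continuous fun s => h * Real.exp (-c) * Real.exp (σ₀ - s)).intervalIntegrable
          _ _)]
      simp only [sub_self, Real.exp_zero, show σ₀ - (σ₀ + L) = -L by ring]
      ring
    linarith
  -- `L → ∞`
  have hfin : h * Real.exp (-c) ≤ M := by
    refine le_of_forall_pos_lt_add fun δ hδ => ?_
    have hk : 0 < h * Real.exp (-c) + 1 := by positivity
    -- choose `L` with `e^{-L} (h e^{-c}) < δ`
    obtain ⟨L, hL, hL0⟩ : ∃ L, Real.exp (-L) * (h * Real.exp (-c) + 1) < δ ∧ 0 ≤ L := by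
      have hlim : Tendsto (fun L : ℝ => Real.exp (-L) * (h * Real.exp (-c) + 1)) atTop
          (𝓝 (0 * (h * Real.exp (-c) + 1))) :=
        Real.tendsto_exp_neg_atTop_nhds_zero.mul_const _
      rw [zero_mul] at hlim
      exact ((hlim.eventually (gt_mem_nhds hδ)).and (eventually_ge_atTop 0)).exists
    have h1 := hint L hL0
    have h2 : h * Real.exp (-c) * Real.exp (-L) ≤ Real.exp (-L) * (h * Real.exp (-c) + 1) := by
      nlinarith [Real.exp_pos (-L), Real.exp_pos (-c)]
    nlinarith
  -- conclude
  have e5 : M * Real.exp c * Real.exp (-c) = M := by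
    rw [mul_assoc, ← Real.exp_add]; simp
  calc ‖W b σ₀‖ = h := rfl
    _ = h * Real.exp (-c) * Real.exp c := by rw [mul_assoc, ← Real.exp_add]; simp
    _ ≤ M * Real.exp c := mul_le_mul_of_nonneg_right hfin (Real.exp_pos _).le
    _ = M * Real.exp (fluxConst α * (bigLam ε₀)⁻¹ * M + viscCoef ε₀ νh b σ₀) := by rw [hcdef]


/-- **Below the dissipation cutoff the bound is uniform**: at all shells/log-times with
`viscCoef(b, σ₀) = ν̂(1+ε₀)^{2b}e^{-σ₀} ≤ Γ₀` after which shell `b` does not backscatter,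
`‖W_b(σ₀)‖ ≤ M e^{C_A M/Λ + Γ₀}`.  (Above the cutoff the persistence mechanism is silent: dissipation can
absorb a shell's energy without any action being spent by the shell above.)
[cite: Tao2016AveragedNS, §4 Lemma 4.1 (4.8)–(4.10), the viscous equation before Thm. 4.2, §6.4; cell vocabulary] -/
theorem norm_le_of_forwardFlux_of_viscCoef_le (hε : 0 < ε₀) (hc : IsCancellingCoeff α)
    (hW : IsEternalVisc ε₀ νh α W)
    {M : ℝ} (hM : ∀ n : ℤ, Integrable (fun σ => ‖W n σ‖) ∧ ∫ σ, ‖W n σ‖ ≤ M)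
    {Γ₀ : ℝ} (b : ℤ) (σ₀ : ℝ) (hΓ : viscCoef ε₀ νh b σ₀ ≤ Γ₀)
    (hF : ∀ σ, σ₀ ≤ σ → 0 ≤ physFlux ε₀ α W (b - 1) σ) :
    ‖W b σ₀‖ ≤ M * Real.exp (fluxConst α * (bigLam ε₀)⁻¹ * M + Γ₀) := by
  have hM0 : 0 ≤ M := le_trans (integral_nonneg fun _ => norm_nonneg _) (hM 0).2
  exact (norm_le_of_forwardFlux hε hc hW hM b σ₀ hF).trans
    (mul_le_mul_of_nonneg_left (Real.exp_le_exp.2 (by linarith)) hM0)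

/-- **INVISCID FORWARD CASCADES ARE UNIFORMLY BOUNDED.**  On a cancelling table (any `m`, any
`ε₀ > 0`, no comparability or smallness needed), every admissible INVISCID eternal solution
(`IsEternal`) whose energy fluxes are all non-negative — `0 ≤ F_k(σ) ∝ ⟪W_{k+1}, A(W_k)⟫` for all
`k, σ`: energy only ever moves UP the lattice, no backscatter — satisfies `UniformBound W`, with the
explicit constant `M e^{C_A M/Λ}` in terms of any per-shell action bound `M`.  This is the crux
`WakeRatchet.AdmissibleEternalBound` (stmt-23197) on the forward-cascade inviscid slice — e.g. all
non-negative solutions of the dyadic member (`uniformBound_dyadic_of_nonneg`).  What remains of the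
crux is exactly the two LEAKS of the persistence mechanism: backscatter (`F_{b-1} < 0`, energy
returning to larger scales) and the dissipation range (`viscCoef ≫ 1`).
[cite: Tao2016AveragedNS, §4 Lemma 4.1 (4.8)–(4.10) with (4.3), Thm. 4.2 (statement shape), §6.4; cell vocabulary (`IsEternal`, `UniformBound`, `physFlux`)] -/
theorem uniformBound_of_forwardCascade (hε : 0 < ε₀) (hc : IsCancellingCoeff α)
    (hW : IsEternal ε₀ α W) (hF : ∀ (k : ℤ) (σ : ℝ), 0 ≤ physFlux ε₀ α W k σ) :
    UniformBound W := by
  have hWv : IsEternalVisc ε₀ 0 α W := hW.isEternalVisc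
  obtain ⟨M, hM⟩ := hWv.action
  refine ⟨M * Real.exp (fluxConst α * (bigLam ε₀)⁻¹ * M), fun k σ => ?_⟩
  have h := norm_le_of_forwardFlux hε hc hWv hM k σ (fun s _ => hF (k - 1) s)
  have hv : viscCoef ε₀ 0 k σ = 0 := by unfold viscCoef; ring
  rwa [hv, add_zero] at h

/-- **Explicit form**: for an inviscid forward cascade with per-shell action `≤ M`,
`‖W_k(σ)‖ ≤ M e^{C_A M/Λ}` at every shell and log-time.
[cite: Tao2016AveragedNS, §4 Lemma 4.1 (4.8)–(4.10) with (4.3), §6.4; cell vocabulary] -/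
theorem norm_le_of_forwardCascade (hε : 0 < ε₀) (hc : IsCancellingCoeff α)
    (hW : IsEternal ε₀ α W)
    {M : ℝ} (hM : ∀ n : ℤ, Integrable (fun σ => ‖W n σ‖) ∧ ∫ σ, ‖W n σ‖ ≤ M)
    (hF : ∀ (k : ℤ) (σ : ℝ), 0 ≤ physFlux ε₀ α W k σ) (k : ℤ) (σ : ℝ) :
    ‖W k σ‖ ≤ M * Real.exp (fluxConst α * (bigLam ε₀)⁻¹ * M) := by
  have h := norm_le_of_forwardFlux hε hc hW.isEternalVisc hM k σ (fun s _ => hF (k - 1) s)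
  have hv : viscCoef ε₀ 0 k σ = 0 := by unfold viscCoef; ring
  rwa [hv, add_zero] at h

end Persistence

/-! ## The crux on the inviscid forward-cascade slice; the dyadic member -/

/-- **`AdmissibleEternalBound` HOLDS on the inviscid forward-cascade slice** — in the crux's own
quantifier shape (stmt-NavierStokesRegularity-23197), with NO threshold on `ε₀` and for every spread:
every admissible inviscid eternal solution of an E₂(R) table with non-negative energy fluxes is
uniformly bounded.  The unrestricted crux additionally covers backscattering solutions and covariant
viscosity `ν̂ > 0`; those are NOT settled here.  MODEL lattice only; nothing about NS.
[cite: Tao2016AveragedNS, §4 Thm. 4.2 (statement shape), Lemma 4.1 (4.8)–(4.10), §6.4; cell vocabulary] -/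
theorem admissibleEternalBound_inviscid_forwardCascade :
    ∀ R : ℝ, 1 ≤ R → ∀ ε₀ : ℝ, 0 < ε₀ →
      ∀ α : Fin 4 → Fin 4 → Fin 4 → ℤ × ℤ × ℤ → ℝ, InTableClass R α →
        ∀ W : ℤ → ℝ → Em 4, IsEternal ε₀ α W →
          (∀ (k : ℤ) (σ : ℝ), 0 ≤ physFlux ε₀ α W k σ) → UniformBound W :=
  fun _R _hR _ε₀ hε₀ _α hα _W hW hF => uniformBound_of_forwardCascade hε₀ hα.2.1 hW hF

section Dyadic

/-- The energy-transfer pairing of the dyadic member: `⟪y, A(x)⟫ = x₀² y₀`.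
[cite: Tao2016AveragedNS, §1.2 (energy flows from mode `n` to `n+1` at rate `λⁿ X_{n+1} X_n²`), §4 (4.1); cell vocabulary] -/
theorem inner_tableA_dyadicTable (y x : Em 4) : ⟪y, tableA dyadicTable x⟫ = x 0 * x 0 * y 0 := by
  -- the coordinate forms of `dyadicTable` at shift `(0,0,1)` (the computation of
  -- `WakeRatchetDyadicFront.tableA_dyadicTable`, kept local so that this file stays outside the
  -- cone of the route file)
  have hq : ∀ i : Fin 4, qform dyadicTable (0, 0, 1) x x i = if i = 0 then x 0 * x 0 else 0 := by
    intro i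
    unfold qform
    split_ifs with hi
    · subst hi
      rw [Fintype.sum_eq_single (0 : Fin 4) (fun i₁ hi₁ => Finset.sum_eq_zero fun i₂ _ => by
          have : ¬ (i₁ = 0 ∧ i₂ = 0 ∧ (0 : Fin 4) = 0) := fun h => hi₁ h.1
          simp [dyadicTable_of_not this])]
      rw [Fintype.sum_eq_single (0 : Fin 4) (fun i₂ hi₂ => by
          have : ¬ ((0 : Fin 4) = 0 ∧ i₂ = 0 ∧ (0 : Fin 4) = 0) := fun h => hi₂ h.2.1
          simp [dyadicTable_of_not this])]
      simp [dyadicTable]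
    · refine Finset.sum_eq_zero fun i₁ _ => Finset.sum_eq_zero fun i₂ _ => ?_
      have : ¬ (i₁ = 0 ∧ i₂ = 0 ∧ i = 0) := fun h => hi h.2.2
      simp [dyadicTable_of_not this]
  have hA : tableA dyadicTable x = (x 0 * x 0) • EuclideanSpace.single 0 (1 : ℝ) := by
    unfold tableA
    rw [Fintype.sum_eq_single (0 : Fin 4) (fun i hi => by rw [hq, if_neg hi, zero_smul])]
    rw [hq, if_pos rfl]
  rw [hA, real_inner_smul_right, EuclideanSpace.inner_single_right]
  simp

/-- **Every NON-NEGATIVE admissible inviscid eternal solution of the DYADIC member is uniformly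
bounded** (any `ε₀ > 0`): for the Katz–Pavlović / Cheskidov chain embedded as `dyadicTable`, the
energy flux `n → n+1` is `∝ W_{n+1,0} W_{n,0}²`, non-negative as soon as the amplitudes are, so the
persistence bound applies: `‖W_k(σ)‖ ≤ M e^{C_A M/Λ}`.  (Non-negativity is the standard setting of the
dyadic literature; its travelling blow-up fronts, if they exist, are covered.)  MODEL lattice only.
[cite: Tao2016AveragedNS, §1.2 (dyadic model), §4 Lemma 4.1 (4.8)–(4.10), §6.4; cell vocabulary (`dyadicTable`, `IsEternal`, `UniformBound`)] -/
theorem uniformBound_dyadic_of_nonneg {ε₀ : ℝ} (hε : 0 < ε₀) {W : ℤ → ℝ → Em 4}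
    (hW : IsEternal ε₀ dyadicTable W) (hpos : ∀ (k : ℤ) (σ : ℝ), 0 ≤ W k σ 0) :
    UniformBound W := by
  refine uniformBound_of_forwardCascade hε dyadicTable_cancelling hW fun k σ => ?_
  have hΛ : 0 < bigLam ε₀ := bigLam_pos (by linarith)
  have hz : 0 < (bigLam ε₀ ^ k)⁻¹ ^ 2 * (bigLam ε₀)⁻¹ := by
    have := zpow_pos hΛ k
    positivity
  unfold physFlux
  rw [inner_tableA_dyadicTable]
  have : 0 ≤ W k σ 0 * W k σ 0 * W (k + 1) σ 0 :=
    mul_nonneg (mul_self_nonneg _) (hpos (k + 1) σ)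
  positivity

end Dyadic

end WakeRatchetPersistence

end Summit.NavierStokesRegularity.NavierStokesRegularity.Theorems

end
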